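import Mathlib
import HarnessLib
import Summits.AtomisticToContinuum.BoseEinsteinCondensation.Theses.BECStronglyRayleigh
import Literature.MathematicalPhysics.QuantumManyBody.PeriodicBoseGas

/-!
# Sketch — crux-ideate stmt-AtomisticToContinuum-9674 (LatticeToPeriodicBridge), ideator 1, round 1

First checkable statements of the idea `coarse-cell-lorentzian` ("Theorem S one scale up"):

* `TwoBodyCellLorentzian` — the N = 2 anchor: for every repulsive finite-range `v` there is a cell
  size `b₀(v)` such that for all `b ≥ b₀` and every cell torus `(Fin M)³` (side `L = M b`), the
  cell-pair kernel `K(x,y) = ∫_{X₀ ∈ C_x, X₁ ∈ C_y} Ψ` of a real non-negative near-minimiser of the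
  periodic two-body energy is LORENTZIAN in the reverse-Cauchy–Schwarz form
  `(𝟙ᵀK𝟙)(uᵀKu) ≤ (𝟙ᵀKu)²` for all real `u` (⟺ at most one positive eigenvalue, `K ≥ 0`
  entrywise) — the continuum twin of the route's "N = 2 on ℤ^d, K = f_∞(J − G/G(0)) Lorentzian".
* `PairCellLorentzian` (pointwise, exact minimiser), `IntegratedPairCoherence` (robust integrated
  form for near-minimisers — what the coarse assembly consumes), `PeriodicBECShape` +
  `bridge_of_periodicBEC` (composition with the crux by name).
-/

namespace Summit.AtomisticToContinuum.BoseEinsteinCondensation.Cruxes.LatticeToPeriodicBridge.CoarseCellLorentzian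

open MeasureTheory
open Literature.MathematicalPhysics.QuantumManyBody.BoseGas

/-- The cubic cell of side `b` with integer corner `x : Fin 3 → Fin M` inside the torus cell
`[0, M b)³`. -/
def cubeCell (M : ℕ) (b : ℝ) (x : Fin 3 → Fin M) : Set Space :=
  {ξ | ∀ k, ξ k ∈ Set.Ico (((x k : ℕ) : ℝ) * b) ((((x k : ℕ) : ℝ) + 1) * b)}

/-- Two-particle configurations with particle `0` in cell `x` and particle `1` in cell `y`. -/
def cellPair (M : ℕ) (b : ℝ) (x y : Fin 3 → Fin M) : Set (Config 2) :=
  {X | X 0 ∈ cubeCell M b x ∧ X 1 ∈ cubeCell M b y}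

/-- FIRST LEMMA (N = 2 anchor of the coarse-cell Lorentzian line). For every repulsive finite-range
`v` there is `b₀ > 0` such that for all cell sizes `b ≥ b₀`, all `M ≥ 2` and some `δ > 0`, every
real non-negative `δ`-near-minimiser `Ψ` of the periodic two-body energy on the torus of side
`M b` has a cell-pair kernel `K(x,y) = ∫_{cellPair x y} Re Ψ` satisfying the Lorentzian
(reverse Cauchy–Schwarz) inequality `(ΣK)(uᵀKu) ≤ (𝟙ᵀKu)²` for every real `u`.
Mechanism: `Ψ = f(X₀ − X₁)`, `f = f_∞ − w` with `w` the (periodised) zero-energy scattering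
correction, `ŵ(k) = 4π a(k)/k² > 0` for `|k| ≲ 1/a` (for hard spheres `ŵ = 4π sin(ka)/k³`), so the
cell-averaged `W̄` is positive semi-definite once `b ≳ a` (aliasing terms `O(a⁴/b)` against
`≍ a b²`), and `K = b⁶(f_∞ 𝟙𝟙ᵀ − W̄)` has exactly one positive eigenvalue; for `b ≪ a` it FAILS. -/
def TwoBodyCellLorentzian : Prop :=
  ∀ v : ℝ → ENNReal, IsRepulsiveFiniteRange v →
    ∃ b₀ : ℝ, 0 < b₀ ∧ ∀ b : ℝ, b₀ ≤ b → ∀ M : ℕ, 2 ≤ M →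
      ∃ δ : ENNReal, 0 < δ ∧ ∀ Ψ : PeriodicTrialState 2 ((M : ℝ) * b),
        (∀ X, 0 ≤ (Ψ.ψ X).re ∧ (Ψ.ψ X).im = 0) →
        periodicEnergy v Ψ ≤ periodicGroundStateEnergy v 2 ((M : ℝ) * b) + δ →
        let K : (Fin 3 → Fin M) → (Fin 3 → Fin M) → ℝ :=
          fun x y => ∫ X in cellPair M b x y, (Ψ.ψ X).re
        ∀ u : (Fin 3 → Fin M) → ℝ,
          (∑ x, ∑ y, K x y) * (∑ x, ∑ y, u x * K x y * u y) ≤ (∑ x, ∑ y, K x y * u y) ^ 2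

/-- Configurations of `N' + 2` particles assembled from a tagged pair `(ξ, η)` and a background `X'`. -/
def pairCons {N' : ℕ} (ξ η : Space) (X' : Config N') : Config (N' + 2) :=
  Fin.cons ξ (Fin.cons η X')

/-- THE CONJECTURE OF THE LINE (continuum Theorem S, pair-coarse form = what the coarse assembly
consumes). For every repulsive finite-range `v` there are a cell size `b₀(v)` and a density
`ρ₀(v) > 0` such that on every cell torus of side `M b` (`b ≥ b₀`, `M ≥ 2`) and for every particle
number `N' + 2 ≤ ρ₀ (M b)³`, every real non-negative near-minimiser `Ψ` has, for EVERY background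
`X'` of the other `N'` particles at fixed continuum positions, a Lorentzian cell-pair kernel
`K_{X'}(x,y) = ∫_{ξ ∈ C_x} ∫_{η ∈ C_y} Ψ(ξ, η, X')`: `(ΣK)(uᵀKu) ≤ (𝟙ᵀKu)²` for all real `u`.
Only the PAIR is coarse-grained (cells `b ≳ a`); the background stays fine, so no `L²`-mass is lost
beyond the two-particle Poincaré factor `1 − 8aρb²/π`. Lattice twin: "∂^T p is a Lorentzian
quadratic for every T" (consequence of GroundStateStability). N' = 0 is `TwoBodyCellLorentzian`.
POINTWISE in `X'`, hence stated for the EXACT (real, non-negative) minimiser only: `Ψ ↦ K_{X'}(Ψ)`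
at a fixed background is not `L²`-continuous, so a `δ`-near-minimiser form of this pointwise
statement would fail trivially (a tiny `C¹` bump near one background `X'₀`); the robust form the
assembly consumes is `IntegratedPairCoherence` below. (For hard cores no `C¹` minimiser exists and
this pointwise statement is vacuous — the integrated form is the operative one.) -/
def PairCellLorentzian : Prop :=
  ∀ v : ℝ → ENNReal, IsRepulsiveFiniteRange v →
    ∃ b₀ ρ₀ : ℝ, 0 < b₀ ∧ 0 < ρ₀ ∧ ∀ b : ℝ, b₀ ≤ b → ∀ M : ℕ, 2 ≤ M → ∀ N' : ℕ,
      ((N' : ℝ) + 2) ≤ ρ₀ * ((M : ℝ) * b) ^ 3 →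
      ∀ Ψ : PeriodicTrialState (N' + 2) ((M : ℝ) * b),
        (∀ X, 0 ≤ (Ψ.ψ X).re ∧ (Ψ.ψ X).im = 0) →
        periodicEnergy v Ψ = periodicGroundStateEnergy v (N' + 2) ((M : ℝ) * b) →
        ∀ X' : Config N',
          let K : (Fin 3 → Fin M) → (Fin 3 → Fin M) → ℝ :=
            fun x y => ∫ ξ in cubeCell M b x, ∫ η in cubeCell M b y, (Ψ.ψ (pairCons ξ η X')).re
          ∀ u : (Fin 3 → Fin M) → ℝ,
            (∑ x, ∑ y, K x y) * (∑ x, ∑ y, u x * K x y * u y) ≤ (∑ x, ∑ y, K x y * u y) ^ 2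

/-- THE ROBUST (ASSEMBLY) FORM: the continuum twin of the route's `StableImpliesPairCoherence`
CONCLUSION, integrated over backgrounds — for real non-negative `δ`-near-minimisers (δ existential,
sub-gap), with `K_{X'}`, `r_{X'}(x) = Σ_y K_{X'}(x,y)`, `R_{X'} = Σ_x r_{X'}(x)`:
`∫ dX' ‖K_{X'}‖_F² ≤ ∫ dX' [ Σ_x r_x³ / R + ‖r‖⁴ / R² ]` (Lean's `x/0 = 0` matches `K_{X'} = 0`).
It follows pointwise in `X'` from Lorentz signature (rank-one dominance, the route's proof of 9675)
for the exact minimiser and is `L²`-continuous in `Ψ`, hence inherited by near-minimisers; together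
with the "≥" cell version of `PairKernelSumRule`, norm retention `∫‖K‖²_F ≥ b⁶(1 − 8aρb²/π)` and a
delocalisation bound `M³∫‖r‖²Φ ≤ 𝕄∫‖r‖²` it yields `condensateOccupation ≥ (1 − 8aρb²/π) N / 𝕄`. -/
def IntegratedPairCoherence : Prop :=
  ∀ v : ℝ → ENNReal, IsRepulsiveFiniteRange v →
    ∃ b₀ ρ₀ : ℝ, 0 < b₀ ∧ 0 < ρ₀ ∧ ∀ b : ℝ, b₀ ≤ b → ∀ M : ℕ, 2 ≤ M → ∀ N' : ℕ,
      ((N' : ℝ) + 2) ≤ ρ₀ * ((M : ℝ) * b) ^ 3 →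
      ∃ δ : ENNReal, 0 < δ ∧ ∀ Ψ : PeriodicTrialState (N' + 2) ((M : ℝ) * b),
        (∀ X, 0 ≤ (Ψ.ψ X).re ∧ (Ψ.ψ X).im = 0) →
        periodicEnergy v Ψ ≤ periodicGroundStateEnergy v (N' + 2) ((M : ℝ) * b) + δ →
        let K : Config N' → (Fin 3 → Fin M) → (Fin 3 → Fin M) → ℝ :=
          fun X' x y => ∫ ξ in cubeCell M b x, ∫ η in cubeCell M b y, (Ψ.ψ (pairCons ξ η X')).re
        let r : Config N' → (Fin 3 → Fin M) → ℝ := fun X' x => ∑ y, K X' x y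
        (∫ X' in cellN N' ((M : ℝ) * b), ∑ x, ∑ y, K X' x y ^ 2) ≤
          ∫ X' in cellN N' ((M : ℝ) * b),
            ((∑ x, r X' x ^ 3) / (∑ x, r X' x) + (∑ x, r X' x ^ 2) ^ 2 / (∑ x, r X' x) ^ 2)

/-- TARGET SHAPE (what the line must finally deliver, per cell partition; informal content = the
crux's consequent PeriodicBEC): a uniform lower bound `c N` on `condensateOccupation` for
near-minimisers at density `ρ < ρ₀(v)`.  Written out so that the composition with the crux is by
name: this is literally the consequent of `LatticeToPeriodicBridge`. -/
def PeriodicBECShape : Prop :=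
  ∀ v : ℝ → ENNReal, IsRepulsiveFiniteRange v → ∃ ρ₀ : ℝ, 0 < ρ₀ ∧ ∀ ρ : ℝ, 0 < ρ → ρ < ρ₀ →
    ∃ c : ℝ, 0 < c ∧ ∀ᶠ N : ℕ in Filter.atTop, ∃ δ : ENNReal, 0 < δ ∧
      ∀ Ψ : PeriodicTrialState N (sideLength ρ N),
        periodicEnergy v Ψ ≤ periodicGroundStateEnergy v N (sideLength ρ N) + δ →
        ENNReal.ofReal (c * N) ≤ condensateOccupation N (sideLength ρ N) Ψ.ψ

/-- Sanity: the consequent shape composes with the crux by name — any proof of `PeriodicBECShape`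
closes `LatticeToPeriodicBridge` (the antecedent is then unused; an honest feature of every
"scheme-transfer" line for this crux, recorded here so triage can see it). -/
theorem bridge_of_periodicBEC (h : PeriodicBECShape) :
    Summit.AtomisticToContinuum.BoseEinsteinCondensation.Theses.BECStronglyRayleigh.LatticeToPeriodicBridge :=
  fun _ => h

end Summit.AtomisticToContinuum.BoseEinsteinCondensation.Cruxes.LatticeToPeriodicBridge.CoarseCellLorentzian
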